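import Mathlib
import HarnessLib
import Summits.HubbardSuperconductivity.HubbardSuperconductivity.Theorems.WeakCouplingBCSKlCertTPrimeChannelBound

/-!
# «(KLSCAN)-TPRIME-SOUNDNESS» (4/5): block-level soundness at hopping `t′` (`EnclosureTP`, `RitzEnclosureTP`, `baseKernelTP`)

Cell `gate-hubbard-kl`, seat p3 (g20); located item «(KLSCAN)-TPRIME-SOUNDNESS» (pen (R269)(D)/(R279); director INBOX l.284 KL-MARGIN-SCAN (α)).
HYPOTHESIS STYLE: the t′ = 0 soundness chain behind `klb1gd_window(_U)` (`…ChannelOps` → `…BottomStates` → `…ChannelBound` → `…ChannelFar` →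
`…BlockBounds` → `…KlCertFormD`) re-keyed VERBATIM at an arbitrary dispersion `ε` / at `squareDispersion 1 tp`, with the five analytic leaves
(finite Fermi-curve measure, `D₄` measure preservation, Hilbert–Schmidt Lindhard kernel, `D₄`-invariance of `χ₀`, channel-state existence) carried
as ONE hypothesis `KLTPAnalytic ε μ` instead of the registered `stub_kl*` leaves (which prove them at `t′ = 0`, `μ ∈ (−4,0)`: `klTPAnalytic_zero`).
Nothing here asserts a certificate at any `t′ ≠ 0`, the margin, the window or superconductivity.  `--supports stmt-HubbardSuperconductivity-0158` (helper).
References: M. Reed, B. Simon, *Methods of Modern Mathematical Physics* I Thm. VI.16/VI.23, IV Thm. XIII.5; S. Raghu, S. A. Kivelson, D. J. Scalapino,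
Phys. Rev. B 81 (2010) 224505, §II–§III.
This file: `kltp_tr_toFun_memLp`, `kltp_bkb_sqmass_eq/_temple/_far`, `kltp_blockBounds` (twins of `…BlockBounds` at `squareDispersion 1 tp`),
`kltp_channelFar_mult`, `kltp_d_bkb_far`, `kltp_d_blockLower` (twins of `…KlCertFormD` §blocks), `kltp_bddBelow`, `kltp_ritz_upper` (twins of `…KlCertForm`).
-/

noncomputable section

set_option linter.dupNamespace false

namespace Summit.HubbardSuperconductivity.HubbardSuperconductivity.Theorems

open MeasureTheory Literature.MathematicalPhysics.QuantumLattice Literature.Analysis.OperatorTheory CwKLChiralWindow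
open Summit.HubbardSuperconductivity.HubbardSuperconductivity.Theorems.CwKLChiralWindow.Negative
open scoped InnerProductSpace Pointwise

/-! ## Trial functions in `L²` of any finite Fermi-curve measure -/

/-- **Trial functions are square integrable** on every FINITE Fermi-curve measure (generic twin of `kl_tr_toFun_memLp`). [folklore] -/
theorem kltp_tr_toFun_memLp (t : KLTrig) {ε : Momentum → ℝ} {μ : ℝ} (hμ : KLTPAnalytic ε μ) :
    MemLp t.toFun 2 (fermiCurveMeasure ε μ) := by
  classical
  haveI : IsFiniteMeasure (fermiCurveMeasure ε μ) := hμ.1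
  refine MemLp.of_bound (kl_tr_measurable_toFun t).aestronglyMeasurable
    ((t.cosC.map fun p : ℕ × ℚ => |(p.2 : ℝ)|).sum + (t.sinC.map fun p : ℕ × ℚ => |(p.2 : ℝ)|).sum)
    (Filter.Eventually.of_forall fun k => ?_)
  rw [Real.norm_eq_abs]
  unfold KLTrig.toFun
  split_ifs with hk
  · rw [abs_zero]
    exact add_nonneg (List.sum_nonneg (by intro x hx; simp only [List.mem_map] at hx; obtain ⟨p, -, rfl⟩ := hx; exact abs_nonneg _))
      (List.sum_nonneg (by intro x hx; simp only [List.mem_map] at hx; obtain ⟨p, -, rfl⟩ := hx; exact abs_nonneg _))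
  · exact kl_tr_eval_bound t _

/-! ## BlockBounds at `squareDispersion 1 tp` with `EnclosureTP` -/

/-- The deflated sector square mass of a block, written in the form of the abstract channel theorems. [folklore] -/
theorem kltp_bkb_sqmass_eq (b : KLBlock) (tab : List KLTrig) (tp μ : ℝ) (χ : D4Irrep) :
    ∫ z, (d4Project χ (fun q => (if b.withU then 1 else 0) + lindhardFunction (squareDispersion 1 tp) μ (z.1 + q)) z.2 -
        ∑ m : Fin b.defl.length, ((b.defl[(m : ℕ)].1 : ℚ) : ℝ) *
          ((klTab tab b.defl[(m : ℕ)].2).toFun z.1 * (klTab tab b.defl[(m : ℕ)].2).toFun z.2)) ^ 2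
        ∂(fermiCurveMeasure (squareDispersion 1 tp) μ).prod (fermiCurveMeasure (squareDispersion 1 tp) μ) =
    ∫ z, (b.sectorKernelTP tp μ χ z.1 z.2 - b.deflKernel tab z.1 z.2) ^ 2
        ∂(fermiCurveMeasure (squareDispersion 1 tp) μ).prod (fermiCurveMeasure (squareDispersion 1 tp) μ) := by
  simp only [KLBlock.sectorKernelTP, KLBlock.baseKernelTP, kl_bkb_deflKernel_eq]


/-- **Temple/Ritz bounds of a block.** If the checker accepts the Temple data of the block (`templeOK`) and the block
enclosures hold at `μ`, then `min (f ρlo) (f ρhi) ≤ channelInf ε₀ μ 1 χ` with `f ρ = (β ρ - α)/(β - ρ)` (all data the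
block's rationals `rholo, rhohi, alpha, beta`), and in the equality case `withU ∨ χ ≠ A1g` also
`channelInf ε₀ μ 1 χ ≤ ρhi`: `stub_klChannelBound` with the block's trial `b.trialFun tab` and deflation list. [folklore] -/
theorem kltp_bkb_temple {tp μ : ℝ} (hμ : KLTPAnalytic (squareDispersion 1 tp) μ) (b : KLBlock) (tab : List KLTrig) (χ : D4Irrep)
    (hT : b.templeOK tab χ = true) (hE : b.EnclosureTP tab tp μ χ) :
    min (((b.beta : ℝ) * (b.rholo : ℝ) - (b.alpha : ℝ)) / ((b.beta : ℝ) - (b.rholo : ℝ)))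
        (((b.beta : ℝ) * (b.rhohi : ℝ) - (b.alpha : ℝ)) / ((b.beta : ℝ) - (b.rhohi : ℝ))) ≤
      channelInf (squareDispersion 1 tp) μ 1 χ ∧
    ((b.withU = true ∨ χ ≠ D4Irrep.A1g) → channelInf (squareDispersion 1 tp) μ 1 χ ≤ (b.rhohi : ℝ)) := by
  have hT' := hT
  simp only [KLBlock.templeOK, KLBlock.ritzOK, Bool.and_eq_true, decide_eq_true_eq] at hT'
  obtain ⟨⟨⟨⟨⟨⟨⟨⟨⟨⟨⟨⟨hut, -⟩, hfits⟩, hNlo⟩, -⟩, -⟩, hQhi⟩, hwu⟩, hdefl⟩, hThi⟩, hβ0⟩, hHβ⟩, hρβ⟩ := hT'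
  obtain ⟨hE1, hE2⟩ := hE
  obtain ⟨h1, h2, h3, h4, h5⟩ := hE1 hut
  simp only [KLBlock.baseKernelTP] at h3 h4 h5
  obtain ⟨hN, hρlo, hρhi, hρhi0, hα⟩ :=
    kl_bkb_arith (by exact_mod_cast hNlo) (by exact_mod_cast hQhi) (by exact_mod_cast hThi) h1 h2 h3 h4 h5
  have hrholo : ((b.rholo : ℚ) : ℝ) = min ((b.Qlo : ℝ) / (b.Nlo : ℝ)) ((b.Qlo : ℝ) / (b.Nhi : ℝ)) := by
    push_cast [KLBlock.rholo]; rfl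
  have hrhohi : ((b.rhohi : ℚ) : ℝ) = max ((b.Qhi : ℝ) / (b.Nlo : ℝ)) ((b.Qhi : ℝ) / (b.Nhi : ℝ)) := by
    push_cast [KLBlock.rhohi]; rfl
  have halpha : ((b.alpha : ℚ) : ℝ) = (b.Thi : ℝ) / (b.Nlo : ℝ) := by
    push_cast [KLBlock.alpha]; rfl
  rw [← hrholo] at hρlo
  rw [← hrhohi] at hρhi hρhi0
  rw [← halpha] at hα
  have hβ : (b.Hhi : ℝ) - (if χ = D4Irrep.E then 2 else 1) * (b.rhohi : ℝ) ^ 2 ≤ (b.beta : ℝ) ^ 2 := by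
    have h := (Rat.cast_le (K := ℝ)).2 hHβ
    unfold KLBlock.dmult at h
    split_ifs at h ⊢ <;> push_cast at h <;> linarith
  exact kltp_channelBound (squareDispersion 1 tp) μ hμ χ b.withU b.defl.length (fun m => ((b.defl[(m : ℕ)].1 : ℚ) : ℝ))
    (fun m => (klTab tab b.defl[(m : ℕ)].2).toFun) (b.trialFun tab) (b.rholo : ℝ) (b.rhohi : ℝ) (b.alpha : ℝ)
    (b.Hhi : ℝ) (b.beta : ℝ) (kl_bkb_withU hwu) (kl_bkb_defl_nonneg hdefl) (fun m => kltp_tr_toFun_memLp _ hμ)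
    (kltp_tr_toFun_memLp (klTab tab b.trial) hμ) (stub_klTrigChannel (klTab tab b.trial) χ hfits) hN hρlo hρhi hρhi0
    hα ((kltp_bkb_sqmass_eq b tab tp μ χ).trans_le hE2) (by exact_mod_cast hβ0) hβ (by exact_mod_cast hρβ)

/-- **Far-channel bound of a block.** If the checker accepts the far-channel data of the block (`farOK`) and the block
enclosures hold at `μ`, then `-s ≤ channelInf ε₀ μ 1 χ`: `stub_klChannelFar` with the block's deflation list and
`h = Hhi`. [folklore] -/
theorem kltp_bkb_far {tp μ : ℝ} (hμ : KLTPAnalytic (squareDispersion 1 tp) μ) (b : KLBlock) (tab : List KLTrig) (χ : D4Irrep)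
    (hF : b.farOK tab χ = true) (hE : b.EnclosureTP tab tp μ χ) :
    -(b.s : ℝ) ≤ channelInf (squareDispersion 1 tp) μ 1 χ := by
  have hF' := hF
  simp only [KLBlock.farOK, Bool.and_eq_true, decide_eq_true_eq] at hF'
  obtain ⟨⟨⟨hdefl, hs⟩, hHs⟩, hwu⟩ := hF'
  exact kltp_channelFar (squareDispersion 1 tp) μ hμ χ b.withU b.defl.length (fun m => ((b.defl[(m : ℕ)].1 : ℚ) : ℝ))
    (fun m => (klTab tab b.defl[(m : ℕ)].2).toFun) (b.Hhi : ℝ) (b.s : ℝ) (kl_bkb_withU hwu)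
    (kl_bkb_defl_nonneg hdefl) (fun m => kltp_tr_toFun_memLp _ hμ) ((kltp_bkb_sqmass_eq b tab tp μ χ).trans_le hE.2)
    (by exact_mod_cast hs) (by exact_mod_cast hHs)

/-! ### The stub -/

/-- **Block-level soundness of the checker's bounds** (`stub_klBlockBounds`): for a block `b` with its enclosures at the
level `μ ∈ (-4,0)` in the channel `χ`: if the checker certifies a lower bound (`lowerOK`: Temple data or far-channel data)
then `b.lower tab χ ≤ channelInf ε₀ μ 1 χ` (`…ChannelBound` with the trial `Φ = b.trialFun tab`, `ρlo = b.rholo`,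
`ρhi = b.rhohi`, `α = b.alpha`, `h = b.Hhi`, `β = b.beta` and the deflation of the block, or `…ChannelFar` with `s = b.s`);
if it accepts Temple data and the block is in the equality case (`withU ∨ χ ≠ A1g`) then `channelInf ε₀ μ 1 χ ≤ b.upper`
(Ritz). [folklore] -/
theorem kltp_blockBounds (tp : ℝ) : ∀ μ : ℝ, KLTPAnalytic (squareDispersion 1 tp) μ → ∀ (b : KLBlock) (tab : List KLTrig) (χ : D4Irrep),
    b.EnclosureTP tab tp μ χ →
    (b.lowerOK tab χ = true → ((b.lower tab χ : ℚ) : ℝ) ≤ channelInf (squareDispersion 1 tp) μ 1 χ) ∧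
    (b.templeOK tab χ = true → (b.withU = true ∨ χ ≠ D4Irrep.A1g) →
      channelInf (squareDispersion 1 tp) μ 1 χ ≤ ((b.upper : ℚ) : ℝ)) := by
  intro μ hμ b tab χ hE
  refine ⟨fun hL => ?_, fun hT hcase => (kltp_bkb_temple hμ b tab χ hT hE).2 hcase⟩
  cases hT : b.templeOK tab χ with
  | true =>
    have h := (kltp_bkb_temple hμ b tab χ hT hE).1
    rw [KLBlock.lower, if_pos hT]
    push_cast [KLBlock.temple]
    exact h
  | false =>
    have hF : b.farOK tab χ = true := by simpa [KLBlock.lowerOK, hT] using hL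
    simp only [KLBlock.lower, hT, Bool.false_eq_true, ↓reduceIte]
    push_cast
    exact kltp_bkb_far hμ b tab χ hF hE

/-! ## Far bound with multiplicity, generic; block lower bound at `t′` -/

set_option maxHeartbeats 800000 in
/-- **The far-channel bound with the symmetry multiplicity** (`stub_klChannelFar` sharpened on `E`): for `μ ∈ (-4,0)`,
a channel `χ`, the base kernel `κ = [withU] + χ₀` (`withU → χ = A1g`) and an admissible deflation with
`∫∫ (K_χ - Σ c u⊗u)² ≤ h ≤ d_χ s²`, `s ≥ 0`, `d_E = 2`, `d_χ = 1` otherwise: `-s ≤ channelInf ε₀ μ 1 χ`.  On `E` every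
negative eigenvalue of the sector compression is a doublet (`doublet_of_isometry` with the quarter turn `U₁` of
`stub_klChannelOps`), so the negative square mass `≤ h` forces `2 λ_min² ≤ h`. [folklore] -/
theorem kltp_channelFar_mult (ε : Momentum → ℝ) : ∀ μ : ℝ, KLTPAnalytic ε μ → ∀ (χ : D4Irrep) (withU : Bool) (M : ℕ) (c : Fin M → ℝ)
    (u : Fin M → Momentum → ℝ) (h s : ℝ),
    (withU = true → χ = D4Irrep.A1g) → (∀ m, 0 ≤ c m) →
    (∀ m, MemLp (u m) 2 (fermiCurveMeasure ε μ)) →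
    ∫ z, (d4Project χ (fun q => (if withU then 1 else 0) + lindhardFunction ε μ (z.1 + q)) z.2 -
        ∑ m, c m * (u m z.1 * u m z.2)) ^ 2
        ∂(fermiCurveMeasure ε μ).prod (fermiCurveMeasure ε μ) ≤ h →
    0 ≤ s → h ≤ (if χ = D4Irrep.E then 2 else 1) * s ^ 2 →
    -s ≤ channelInf ε μ 1 χ := by
  intro μ hμ χ withU M c u h s hU hc hu hH hs hhs
  haveI : IsFiniteMeasure (fermiCurveMeasure ε μ) := hμ.1
  obtain ⟨A, P, U₁, hA, hAinner, hAsa, hAc, hAP, -, -, -, hPfix, hPrepr, -, hAU, hPU, hUinner, hEskew, hHS, hBpos⟩ :=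
    @kltp_channelOps ε μ hμ.1 hμ.2.1 hμ.2.2.1 hμ.2.2.2.1 χ withU M c u hu hU hc
  obtain ⟨V, hmemV, hVc⟩ : ∃ V : Submodule ℝ (Lp ℝ 2 (fermiCurveMeasure ε μ)),
      (∀ v, v ∈ V ↔ P v = v) ∧ CompleteSpace V :=
    ⟨_, fun v => kl_cb_mem_ker_iff P v, (ContinuousLinearMap.isClosed_ker _).completeSpace_coe⟩
  haveI : CompleteSpace V := hVc
  have hVA : ∀ v ∈ V, A v ∈ V := by
    intro v hv
    rw [hmemV] at hv ⊢
    have h1 := congrArg (fun f => f v) hAP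
    simp only [mul_apply_eq_comp] at h1
    rw [hv] at h1
    exact h1.symm
  obtain ⟨T, hT, hTsa', hTc'⟩ := exists_compression A V hVA
  -- multiplicity
  obtain ⟨d, hd, hdcast, hdE, hdnE⟩ : ∃ d : ℕ, 1 ≤ d ∧ (d : ℝ) = (if χ = D4Irrep.E then 2 else 1 : ℝ) ∧
      (χ = D4Irrep.E → d = 2) ∧ (χ ≠ D4Irrep.E → d = 1) := by
    by_cases hE : χ = D4Irrep.E
    · exact ⟨2, by norm_num, by rw [if_pos hE]; norm_num, fun _ => rfl, fun h => absurd hE h⟩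
    · exact ⟨1, le_rfl, by rw [if_neg hE]; norm_num, fun h => absurd h hE, fun _ => rfl⟩
  have hmult : ∀ (c' : ℝ) (v : V), c' < 0 → v ≠ 0 → T v = (c' : ℝ) • v →
      ∃ w : Fin d → V, Orthonormal ℝ w ∧ ∀ j, T (w j) = (c' : ℝ) • w j := by
    by_cases hE : χ = D4Irrep.E
    · rw [hdE hE]
      have hUV : ∀ v ∈ V, U₁ v ∈ V := by
        intro v hv
        rw [hmemV] at hv ⊢
        have h1 := congrArg (fun f => f v) hPU
        simp only [mul_apply_eq_comp] at h1
        rw [hv] at h1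
        exact h1
      have horth : ∀ v ∈ V, inner ℝ v (U₁ v) = 0 := fun v hv => hEskew hE v ((hmemV v).1 hv)
      exact doublet_of_isometry (𝕜 := ℝ) hT hAU hUV hUinner horth
    · rw [hdnE hE]
      intro c' v _ hv hTv
      have hvn : ‖(v : Lp ℝ 2 (fermiCurveMeasure ε μ))‖ ≠ 0 := by
        rw [Submodule.norm_coe]; exact norm_ne_zero_iff.2 hv
      refine ⟨![(‖(v : Lp ℝ 2 (fermiCurveMeasure ε μ))‖⁻¹ : ℝ) • v], ?_, ?_⟩
      · rw [orthonormal_iff_ite]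
        intro i j
        fin_cases i; fin_cases j
        simp only [Fin.zero_eta, Fin.isValue, Matrix.cons_val_fin_one, ↓reduceIte]
        rw [Submodule.coe_inner, Submodule.coe_smul, real_inner_smul_left, real_inner_smul_right,
          real_inner_self_eq_norm_sq]
        field_simp
      · intro j
        fin_cases j
        simp only [Fin.zero_eta, Fin.isValue, Matrix.cons_val_fin_one, map_smul, hTv]
        rw [smul_comm]
  -- negative square mass
  have hfam : ∀ (m : ℕ) (f : Fin m → Lp ℝ 2 (fermiCurveMeasure ε μ)), Orthonormal ℝ f →
      (∀ j, f j ∈ V) →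
      ∑ j, ‖A (f j) - (∑ m, c m • (innerSL ℝ ((hu m).toLp (u m))).smulRight ((hu m).toLp (u m))) (f j)‖ ^ 2 ≤ h :=
    fun m f hf hfV => (hHS m f hf fun j => (hmemV _).1 (hfV j)).trans hH
  have hsq := negSqMass_le_of_family_bound (𝕜 := ℝ) hT (fun y => by simpa using hBpos y) hfam
  have hhs' : h ≤ (d : ℝ) * s ^ 2 := by rw [hdcast]; exact hhs
  have hray : ∀ y : V, -s * ‖y‖ ^ 2 ≤ inner ℝ y (T y) := fun y =>
    klb1gd_rayleigh_ge_neg_of_negSqMass_le_mult (hTc' hAc) (hTsa' hAsa) hd hmult hs hhs'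
      (fun m w c' hw hcw => hsq m w c' hw (fun j => by simpa using hcw j)) y
  -- dictionary: every channel state has pairing form `≥ -s`
  have hlow : ∀ ψ, IsChannelState ε μ χ ψ → -s ≤ pairingForm ε μ 1 ψ := by
    intro ψ hψ
    have hvae : (hψ.1.toLp ψ : Momentum → ℝ) =ᵐ[fermiCurveMeasure ε μ] ψ := hψ.1.coeFn_toLp
    have hvV : P (hψ.1.toLp ψ) = hψ.1.toLp ψ := hPfix ψ hψ.1 hψ.2.2
    have hvnorm : ‖hψ.1.toLp ψ‖ = 1 := by
      have h2 : ‖hψ.1.toLp ψ‖ ^ 2 = 1 := by rw [kl_bs_norm_sq_eq_integral_of_ae_eq hvae, hψ.2.1]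
      exact (pow_eq_one_iff_of_nonneg (norm_nonneg _) two_ne_zero).1 h2
    have h1 := hray ⟨hψ.1.toLp ψ, (hmemV _).2 hvV⟩
    rw [(compression_inner_norm hT _).1] at h1
    change -s * ‖hψ.1.toLp ψ‖ ^ 2 ≤ inner ℝ (hψ.1.toLp ψ) (A (hψ.1.toLp ψ)) at h1
    rw [hvnorm, one_pow, mul_one, kl_bs_inner_eq_of_ae_eq
      (fun q => (if withU then 1 else 0) + lindhardFunction ε μ q) A hAinner hvae] at h1
    exact h1.trans (kltp_cb_pairingForm_ge hμ hU hψ).1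
  have hne : ((pairingForm ε μ 1) '' {ψ | IsChannelState ε μ χ ψ}).Nonempty :=
    (hμ.2.2.2.2 χ).image _
  exact le_csInf hne (by rintro r ⟨ψ, hψ, rfl⟩; exact hlow ψ hψ)

/-! ### Block level: the multiplicity-aware far test is sound -/

/-- **Far-channel bound of a block, multiplicity-aware test.** If the checker accepts `farOKd` for the block in the
channel `χ` and the block enclosures hold at `μ ∈ (-4,0)`, then `-s ≤ channelInf ε₀ μ 1 χ` (`klb1gd_channelFar_mult` with
the block's deflation list, `h = Hhi`). [folklore] -/
theorem kltp_d_bkb_far {tp μ : ℝ} (hμ : KLTPAnalytic (squareDispersion 1 tp) μ) (b : KLBlock) (tab : List KLTrig) (χ : D4Irrep)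
    (hF : b.farOKd tab χ = true) (hE : b.EnclosureTP tab tp μ χ) :
    -(b.s : ℝ) ≤ channelInf (squareDispersion 1 tp) μ 1 χ := by
  have hF' := hF
  simp only [KLBlock.farOKd, Bool.and_eq_true, decide_eq_true_eq] at hF'
  obtain ⟨⟨⟨hdefl, hs⟩, hHs⟩, hwu⟩ := hF'
  have hHs' : (b.Hhi : ℝ) ≤ (if χ = D4Irrep.E then 2 else 1) * (b.s : ℝ) ^ 2 := by
    have h := (Rat.cast_le (K := ℝ)).2 hHs
    unfold KLBlock.dmult at h
    split_ifs at h ⊢ <;> push_cast at h <;> linarith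
  exact kltp_channelFar_mult (squareDispersion 1 tp) μ hμ χ b.withU b.defl.length (fun m => ((b.defl[(m : ℕ)].1 : ℚ) : ℝ))
    (fun m => (klTab tab b.defl[(m : ℕ)].2).toFun) (b.Hhi : ℝ) (b.s : ℝ) (kl_bkb_withU hwu)
    (kl_bkb_defl_nonneg hdefl) (fun m => kltp_tr_toFun_memLp _ hμ) ((kltp_bkb_sqmass_eq b tab tp μ χ).trans_le hE.2)
    (by exact_mod_cast hs) hHs'

/-- **Block-level soundness of the multiplicity-aware lower-bound test**: `lowerOKd → lower ≤ channelInf ε₀ μ 1 χ`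
(Temple's value if `templeOK`, `stub_klBlockBounds`; else `-s`, `kltp_d_bkb_far`). [folklore] -/
theorem kltp_d_blockLower {tp μ : ℝ} (hμ : KLTPAnalytic (squareDispersion 1 tp) μ) (b : KLBlock) (tab : List KLTrig) (χ : D4Irrep)
    (hE : b.EnclosureTP tab tp μ χ) (hL : b.lowerOKd tab χ = true) :
    ((b.lower tab χ : ℚ) : ℝ) ≤ channelInf (squareDispersion 1 tp) μ 1 χ := by
  cases hT : b.templeOK tab χ with
  | true =>
    have hok : b.lowerOK tab χ = true := by simp [KLBlock.lowerOK, hT]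
    exact (kltp_blockBounds tp μ hμ b tab χ hE).1 hok
  | false =>
    have hF : b.farOKd tab χ = true := by simpa [KLBlock.lowerOKd, hT] using hL
    simp only [KLBlock.lower, hT, Bool.false_eq_true, ↓reduceIte]
    push_cast
    exact kltp_d_bkb_far hμ b tab χ hF hE

/-! ## Ritz upper bound at `t′` -/

/-- The `U = 1` pairing form is bounded below on the channel states (Hilbert–Schmidt frame), so `channelInf ε₀ μ 1 χ`
is a genuine infimum. [folklore] -/
theorem kltp_bddBelow {tp μ : ℝ} (hμ : KLTPAnalytic (squareDispersion 1 tp) μ) (χ : D4Irrep) :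
    BddBelow (pairingForm (squareDispersion 1 tp) μ 1 '' {ψ | IsChannelState (squareDispersion 1 tp) μ χ ψ}) := by
  set H : ℝ := Real.sqrt (∫ z, (lindhardFunction (squareDispersion 1 tp) μ (z.1 + z.2)) ^ 2
      ∂(fermiCurveMeasure (squareDispersion 1 tp) μ).prod (fermiCurveMeasure (squareDispersion 1 tp) μ)) with hH
  refine ⟨-H, ?_⟩
  rintro x ⟨ψ, hψ, rfl⟩
  obtain ⟨hsplit, hbd⟩ := kltp_frameHS _ μ hμ 1 ψ hψ.1
  rw [hsplit, hψ.2.1, one_mul] at *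
  have := neg_abs_le (∫ k, ψ k * ∫ k', lindhardFunction (squareDispersion 1 tp) μ (k + k') * ψ k'
        ∂fermiCurveMeasure (squareDispersion 1 tp) μ ∂fermiCurveMeasure (squareDispersion 1 tp) μ)
  nlinarith [sq_nonneg (∫ k, ψ k ∂fermiCurveMeasure (squareDispersion 1 tp) μ)]

/-- **Ritz upper bound of a block** (`U = 1`): if the checker accepts the Ritz data of the block in the channel `χ`
(`ritzOK`: trial in the harmonic pattern of `χ`, `0 < Nlo ≤ Nhi`, `Qlo ≤ Qhi < 0`, bare-`U` term only for `A1g`), the block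
is in the equality case (`withU ∨ χ ≠ A1g`) and its Ritz enclosures E1–E2 hold at `μ ∈ (-4,0)`, then
`channelInf ε₀ μ 1 χ ≤ rhohi = max (Qhi/Nlo) (Qhi/Nhi)`: the normalised trial `Φ/‖Φ‖` is a channel state whose `U = 1`
pairing form is `Q/N` (mean zero off `A1g`, `stub_klMeanZero`; the full kernel `1 + χ₀` when `withU`). No Temple data
(`Thi`, `Hhi`, `beta`) are needed. [cite: RaghuKivelsonScalapino2010, §II (7) and (13)] -/
theorem kltp_ritz_upper {tp μ : ℝ} (hμ : KLTPAnalytic (squareDispersion 1 tp) μ) (b : KLBlock) (tab : List KLTrig) (χ : D4Irrep)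
    (hR : b.ritzOK tab χ = true) (hcase : b.withU = true ∨ χ ≠ D4Irrep.A1g) (hE : b.RitzEnclosureTP tab tp μ) :
    channelInf (squareDispersion 1 tp) μ 1 χ ≤ ((b.rhohi : ℚ) : ℝ) := by
  have hR' := hR
  simp only [KLBlock.ritzOK, Bool.and_eq_true, decide_eq_true_eq] at hR'
  obtain ⟨⟨⟨⟨⟨⟨⟨-, -⟩, hfits⟩, hNlo⟩, -⟩, -⟩, hQhi⟩, hwu⟩ := hR'
  obtain ⟨h1, h2, h3, h4⟩ := hE
  obtain ⟨hN, -, hρhi, hρhi0, -⟩ := kl_bkb_arith (Thi := 0) (T := 0) (by exact_mod_cast hNlo) (by exact_mod_cast hQhi)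
    le_rfl h1 h2 h3 h4 le_rfl
  have hrhohi : ((b.rhohi : ℚ) : ℝ) = max ((b.Qhi : ℝ) / (b.Nlo : ℝ)) ((b.Qhi : ℝ) / (b.Nhi : ℝ)) := by
    push_cast [KLBlock.rhohi]; rfl
  rw [← hrhohi] at hρhi hρhi0
  -- the data
  set σ := fermiCurveMeasure (squareDispersion 1 tp) μ with hσ
  set Φ : Momentum → ℝ := b.trialFun tab with hΦ
  set N : ℝ := ∫ k, Φ k ^ 2 ∂σ with hNdef
  haveI hfin : IsFiniteMeasure σ := hμ.1
  have hinv := hμ.2.1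
  have hΦmem : MemLp Φ 2 σ := kltp_tr_toFun_memLp (klTab tab b.trial) hμ
  have hΦch : InChannel χ Φ := stub_klTrigChannel (klTab tab b.trial) χ hfits
  -- the normalised trial
  set c : ℝ := (Real.sqrt N)⁻¹ with hc
  have hsqrt : 0 < Real.sqrt N := Real.sqrt_pos.2 hN
  have hc2N : c ^ 2 * N = 1 := by
    rw [hc, inv_pow, Real.sq_sqrt hN.le, inv_mul_cancel₀ hN.ne']
  have hc2 : 0 < c ^ 2 := by positivity
  set ψ : Momentum → ℝ := fun k => c * Φ k with hψ
  have hψmem : MemLp ψ 2 σ := hΦmem.const_mul c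
  have hψch : InChannel χ ψ := by
    have h := kl_hc_inChannel_linear χ Φ Φ c 0 hΦch hΦch
    simpa using h
  have hψnorm : ∫ k, ψ k ^ 2 ∂σ = 1 := by
    simp only [hψ, mul_pow]
    rw [integral_const_mul]
    exact hc2N
  have hstate : IsChannelState (squareDispersion 1 tp) μ χ ψ := ⟨hψmem, hψnorm, hψch⟩
  -- its `U = 1` pairing form is `c² Q`
  have hval : pairingForm (squareDispersion 1 tp) μ 1 ψ =
      c ^ 2 * ∫ k, Φ k * ∫ k', b.baseKernelTP tp μ k k' * Φ k' ∂σ ∂σ := by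
    cases hw : b.withU with
    | true =>
      have hker : ∀ k k', b.baseKernelTP tp μ k k' = kohnLuttingerKernel (squareDispersion 1 tp) μ 1 k k' := by
        intro k k'
        rw [KLBlock.baseKernelTP, hw, kl_cb_kernel_one]
        simp
      simp_rw [hker]
      rw [← klb1g_form_smul]
      rfl
    | false =>
      have hχ : χ ≠ D4Irrep.A1g := by
        rcases hcase with h | h
        · rw [hw] at h; exact absurd h Bool.false_ne_true
        · exact h
      have hmean : ∫ k, ψ k ∂σ = 0 := (stub_klMeanZero _ _ hfin hinv χ ψ hχ hstate).2
      obtain ⟨hsplit, -⟩ := kltp_frameHS _ μ hμ 1 ψ hψmem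
      have hker : ∀ k k', b.baseKernelTP tp μ k k' = lindhardFunction (squareDispersion 1 tp) μ (k + k') := by
        intro k k'
        rw [KLBlock.baseKernelTP, hw]
        simp
      simp_rw [hker]
      rw [hsplit, hmean, ← klb1g_form_smul σ _ Φ c]
      norm_num
      rfl
  -- conclude
  have hQ : c ^ 2 * ∫ k, Φ k * ∫ k', b.baseKernelTP tp μ k k' * Φ k' ∂σ ∂σ ≤ ((b.rhohi : ℚ) : ℝ) := by
    calc c ^ 2 * ∫ k, Φ k * ∫ k', b.baseKernelTP tp μ k k' * Φ k' ∂σ ∂σ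
        ≤ c ^ 2 * (((b.rhohi : ℚ) : ℝ) * N) := mul_le_mul_of_nonneg_left hρhi hc2.le
      _ = ((b.rhohi : ℚ) : ℝ) * (c ^ 2 * N) := by ring
      _ = ((b.rhohi : ℚ) : ℝ) := by rw [hc2N, mul_one]
  unfold channelInf
  exact (csInf_le (kltp_bddBelow hμ χ) ⟨ψ, hstate, rfl⟩).trans (hval.le.trans hQ)

end Summit.HubbardSuperconductivity.HubbardSuperconductivity.Theorems

end
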